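import Mathlib
import Summits.ResolutionOfSingularities.ResolutionOfSingularities.Theorems.WildQuotientsWildQuotientResolutionFixedPointsRegular
import Summits.ResolutionOfSingularities.ResolutionOfSingularities.Theorems.WildQuotientsTameQuotientResolution
import Summits.ResolutionOfSingularities.ResolutionOfSingularities.Theorems.IndSmoothValuativeSmoothingSmoothBlowupChart
import Literature.AlgebraicGeometry.Resolution.TameQuotientSingularitiesResolution
import Literature.AlgebraicGeometry.Resolution.FiniteQuotientSingularityPresentation
import Literature.AlgebraicGeometry.Resolution.ComponentGluing
import HarnessLib

/-!
# Tame stacky cyclic transfer (crux stmt-ResolutionOfSingularities-15640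
`WildQuotients.WildQuotientResolution`, line `Sketch`, sub-line T2 of `L/w45c/CHAIN.md`)

[OURS · L1 W4.5c] The composite of sub-line T2 (lead c8's HANDOFF step 3, the formalisable image
of the residue-weighted Király–Lütkebohmert game): it replaces the role of a termination theorem
by a TRANSFER statement and is NOT a statement of the manuscript. CONDITIONAL on the named fact
`Literature.AlgebraicGeometry.Resolution.BerghRydh2019_tameQuotientResolution` (Bergh–Rydh 2019,
Thm. 5, constant tame groups; an undischarged `def … : Prop`, taken as the hypothesis `hBR`).

Setting: `k` perfect of characteristic `p`; `X₁` a separated `k`-scheme of finite type;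
`ψ : Y → X₁` proper and birational with `Y` integral (in the application `Y` is the coarse space
of the quotient by `ℤ/p` of a tame stacky equivariant modification of the regular cover `X′`).
Hypothesis (the STACKY TERMINAL STATE, chart by chart): every point of `Y` lies in the image of an
ÉTALE `k`-morphism `Spec ((U^⟨σ⟩)^H) → Y`, where

* `U` is a regular domain of finite type over `k` and `σ : U ≃ₐ[k] U` satisfies `σ ^ p = 1`
  (`σ = 1` is allowed: charts at free points), in the Király–Lütkebohmert terminal state — at every
  `σ`-fixed prime `𝔮` of `U` the augmentation ideal `(σ u - u : u ∈ U)` becomes principal in `U_𝔮`;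
* `U^⟨σ⟩ = FixedPoints.subalgebra k U (Subgroup.zpowers σ)` is the invariant subalgebra, and `H`
  is a finite group of order prime to `p` acting on `U^⟨σ⟩` by `k`-algebra automorphisms
  (the tame residual stabiliser, e.g. the weights `μ_w` of a weighted blow-up when `μ_w(k) ≅ ℤ/w`).

Conclusion: `Scheme.HasResolution X₁`. The graded (diagonalizable) flavour
`tameStackyCyclicTransferGraded` takes charts `Spec ((U^⟨σ⟩)₀) → Y` for a grading of `U^⟨σ⟩` by a
finite abelian group (weighted blow-up charts) and the named fact
`BerghRydh2019_diagonalizableQuotientResolution` instead.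

Proof: `U^⟨σ⟩` is a regular ring (`TameTransfer.isRegularRing_fixedPoints_zpowers`, p460154, from
`CyclicTransfer.isRegularRing_eqLocus` p456188 = Király–Lütkebohmert Thm 2 at fixed primes +
Chase–Harrison–Rosenberg flatness at moved primes; `σ = 1` gives `U^⟨1⟩ = U`), of finite type over
`k` (E. Noether, `finiteType_fixedPointsSubalgebra`), hence SMOOTH over the perfect `k`
(`ValuativeSmoothing.smooth_of_isRegularRing_of_perfectField`); `p ∤ |H|` gives `|H| ≠ 0` in `k`
(`natCast_ne_zero_of_coprime`); so `Y` has finite tame quotient singularities in the sense of the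
named fact, which resolves `Y`; resolutions transfer along the proper birational `ψ`
(`ComponentGluing.Scheme.HasResolution.of_isBirational`).
-/

-- single-problem summit: the doubled namespace component `ResolutionOfSingularities` is forced
set_option linter.dupNamespace false

noncomputable section

open CategoryTheory AlgebraicGeometry
open Literature.AlgebraicGeometry.Resolution

namespace Summit.ResolutionOfSingularities.ResolutionOfSingularities.Theorems.WildQuotientResolution.TameTransfer

/-- The cyclic group generated by an automorphism `σ` with `σ ^ p = 1`, `p` prime, is finite.
[folklore] -/
theorem finite_zpowers_of_pow_eq_one {M : Type*} [Group M] {p : ℕ} (hp : p.Prime) (σ : M)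
    (hσp : σ ^ p = 1) : Finite (Subgroup.zpowers σ) :=
  Set.finite_coe_iff.mpr (isOfFinOrder_iff_pow_eq_one.mpr ⟨p, hp.pos, hσp⟩).finite_zpowers

/-- The invariant subalgebra of the trivial cyclic group is everything. [folklore] -/
theorem fixedPoints_zpowers_one_eq_top (k U : Type) [Field k] [CommRing U] [Algebra k U] :
    FixedPoints.subalgebra k U (Subgroup.zpowers (1 : U ≃ₐ[k] U)) = ⊤ := by
  refine eq_top_iff.mpr fun u _ => ?_
  rw [mem_fixedPoints_zpowers_iff, RingHom.mem_eqLocus, RingHom.id_apply]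
  rfl

/-- **Király–Lütkebohmert terminal state ⟹ `U^⟨σ⟩` regular, `σ = 1` allowed.** For a `k`-algebra
automorphism `σ` with `σ ^ p = 1` (`p` prime) of a regular domain `U` of finite type over `k`
whose augmentation ideal becomes principal at every `σ`-fixed prime, the invariant subalgebra
`FixedPoints.subalgebra k U (zpowers σ)` is a regular ring: for `σ ≠ 1` this is the registered
stub `isRegularRing_fixedPoints_zpowers` (p460154); for `σ = 1` the invariants are all of `U`.
[cite: KiralyLutkebohmert2013, Thm 2] -/
theorem isRegularRing_fixedPoints_zpowers_of_pow_eq_one {k U : Type} [Field k] [CommRing U]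
    [IsDomain U] [IsRegularRing U] [Algebra k U] [Algebra.FiniteType k U] {p : ℕ} (hp : p.Prime)
    (σ : U ≃ₐ[k] U) (hσp : σ ^ p = 1)
    (hdiv : ∀ (𝔮 : Ideal U) [𝔮.IsPrime], 𝔮.comap σ = 𝔮 →
      ((Ideal.span (Set.range fun u : U => σ u - u)).map
        (algebraMap U (Localization.AtPrime 𝔮))).IsPrincipal) :
    IsRegularRing (FixedPoints.subalgebra k U (Subgroup.zpowers σ)) := by
  by_cases hσ1 : σ = 1
  · subst hσ1
    rw [fixedPoints_zpowers_one_eq_top k U]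
    exact IsRegularRing.of_ringEquiv (Subalgebra.topEquiv (R := k) (A := U)).symm.toRingEquiv
  · exact isRegularRing_fixedPoints_zpowers hp σ hσ1 hσp hdiv

/-- **Tame stacky cyclic transfer** [OURS · L1 W4.5c; replaces the role of a termination theorem
for the residue-weighted Király–Lütkebohmert game by a transfer statement; NOT a statement of the
manuscript], CONDITIONAL on the named fact `BerghRydh2019_tameQuotientResolution` (hypothesis
`hBR`). Let `k` be a perfect field of characteristic `p`, `X₁` a separated `k`-scheme of finite
type, and `ψ : Y → X₁` proper and birational with `Y` integral. Suppose every point of `Y` lies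
in the image of an étale `k`-morphism `Spec ((U^⟨σ⟩)^H) → Y`, where `U` is a regular domain of
finite type over `k`, `σ : U ≃ₐ[k] U` with `σ ^ p = 1` is in the Király–Lütkebohmert terminal
state (its augmentation ideal is principal at every `σ`-fixed prime; `σ = 1` allowed),
`U^⟨σ⟩ = FixedPoints.subalgebra k U (zpowers σ)`, and `H` is a finite group of order prime to
`p` acting on `U^⟨σ⟩` by `k`-algebra automorphisms. Then `X₁` has a resolution of
singularities: `U^⟨σ⟩` is regular (`isRegularRing_fixedPoints_zpowers`, Király–Lütkebohmert) and
of finite type (E. Noether), hence smooth over the perfect `k`; Bergh–Rydh resolves `Y`; and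
resolutions transfer along `ψ`. [cite: KiralyLutkebohmert2013, Thm 2]
[cite: BerghRydh2019, Thm 5 (arXiv:1905.00872, p. 4)] -/
theorem tameStackyCyclicTransfer (hBR : BerghRydh2019_tameQuotientResolution)
    {p : ℕ} (hp : p.Prime) (k : Type) [Field k] [CharP k p] [PerfectField k]
    (X₁ : Scheme.{0}) (f : X₁ ⟶ Spec (.of k)) [IsSeparated f] [LocallyOfFiniteType f]
    [QuasiCompact f]
    (Y : Scheme.{0}) (ψ : Y ⟶ X₁) [IsProper ψ] (hbir : IsBirational ψ) [IsIntegral Y]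
    (hcharts : ∀ y : Y, ∃ (U : Type) (_ : CommRing U) (_ : IsDomain U) (_ : IsRegularRing U)
      (_ : Algebra k U) (_ : Algebra.FiniteType k U) (σ : U ≃ₐ[k] U) (_ : σ ^ p = 1)
      (_ : ∀ (𝔮 : Ideal U) [𝔮.IsPrime], 𝔮.comap σ = 𝔮 →
        ((Ideal.span (Set.range fun u : U => σ u - u)).map
          (algebraMap U (Localization.AtPrime 𝔮))).IsPrincipal)
      (H : Type) (_ : Group H) (_ : Finite H)
      (_ : MulSemiringAction H (FixedPoints.subalgebra k U (Subgroup.zpowers σ)))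
      (_ : SMulCommClass H k (FixedPoints.subalgebra k U (Subgroup.zpowers σ))),
      Nat.Coprime (Nat.card H) p ∧
      ∃ φ : Spec (.of (FixedPoints.subalgebra k (FixedPoints.subalgebra k U (Subgroup.zpowers σ))
          H)) ⟶ Y,
        Etale φ ∧ y ∈ Set.range φ.base ∧
        φ ≫ ψ ≫ f = Spec.map (CommRingCat.ofHom (algebraMap k
          (FixedPoints.subalgebra k (FixedPoints.subalgebra k U (Subgroup.zpowers σ)) H)))) :
    Scheme.HasResolution X₁ := by
  haveI : IsSeparated (ψ ≫ f) := inferInstance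
  haveI : LocallyOfFiniteType (ψ ≫ f) := inferInstance
  haveI : QuasiCompact (ψ ≫ f) := inferInstance
  refine ComponentGluing.Scheme.HasResolution.of_isBirational ψ hbir (hBR k Y (ψ ≫ f) fun y => ?_)
  obtain ⟨U, _, _, _, _, hft, σ, hσp, hdiv, H, _, _, _, _, hH, φ, hφ, hy, hcomm⟩ := hcharts y
  haveI : Finite (Subgroup.zpowers σ) := finite_zpowers_of_pow_eq_one hp σ hσp
  haveI := hft
  -- `U^⟨σ⟩` is of finite type (E. Noether) and regular (Király–Lütkebohmert), hence smooth
  have hSft : Algebra.FiniteType k (FixedPoints.subalgebra k U (Subgroup.zpowers σ)) :=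
    inferInstance
  haveI : IsRegularRing (FixedPoints.subalgebra k U (Subgroup.zpowers σ)) :=
    isRegularRing_fixedPoints_zpowers_of_pow_eq_one hp σ hσp hdiv
  have hsm : Algebra.Smooth k (FixedPoints.subalgebra k U (Subgroup.zpowers σ)) :=
    ValuativeSmoothing.smooth_of_isRegularRing_of_perfectField k _
  exact ⟨H, inferInstance, inferInstance, _, inferInstance, inferInstance, inferInstance,
    inferInstance, natCast_ne_zero_of_coprime k hp hH, hSft, hsm, φ, hφ, hy, hcomm⟩

/-- **Tame stacky cyclic transfer, graded (diagonalizable) form** [OURS · L1 W4.5c; the weighted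
blow-up flavour of `tameStackyCyclicTransfer`; NOT a statement of the manuscript], CONDITIONAL on
the named fact `BerghRydh2019_diagonalizableQuotientResolution` (hypothesis `hBR`). Let `k` be a
perfect field of characteristic `p`, `X₁` a separated `k`-scheme of finite type, and
`ψ : Y → X₁` proper and birational with `Y` integral. Suppose every point of `Y` lies in the
image of an étale `k`-morphism `Spec ((U^⟨σ⟩)₀) → Y`, where `U` is a regular domain of finite
type over `k`, `σ : U ≃ₐ[k] U` with `σ ^ p = 1` is in the Király–Lütkebohmert terminal state (its
augmentation ideal is principal at every `σ`-fixed prime; `σ = 1` allowed), and the invariant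
subalgebra `U^⟨σ⟩ = FixedPoints.subalgebra k U (zpowers σ)` carries a grading `𝒮` by a finite
abelian group `A` (the residual diagonalizable stabiliser `D(A)`, e.g. the weights `μ_w` of a
weighted blow-up chart commuting with `σ`), `(U^⟨σ⟩)₀ = 𝒮 0` its degree-zero part. Then `X₁` has
a resolution of singularities: `U^⟨σ⟩` is regular (Király–Lütkebohmert,
`isRegularRing_fixedPoints_zpowers_of_pow_eq_one`) and of finite type (E. Noether), hence smooth
over the perfect `k`; Bergh–Rydh (diagonalizable case) resolves `Y`; resolutions transfer along
`ψ`. [cite: KiralyLutkebohmert2013, Thm 2] [cite: BerghRydh2019, Thm 5 (arXiv:1905.00872, p. 4)] -/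
theorem tameStackyCyclicTransferGraded (hBR : BerghRydh2019_diagonalizableQuotientResolution)
    {p : ℕ} (hp : p.Prime) (k : Type) [Field k] [CharP k p] [PerfectField k]
    (X₁ : Scheme.{0}) (f : X₁ ⟶ Spec (.of k)) [IsSeparated f] [LocallyOfFiniteType f]
    [QuasiCompact f]
    (Y : Scheme.{0}) (ψ : Y ⟶ X₁) [IsProper ψ] (hbir : IsBirational ψ) [IsIntegral Y]
    (hcharts : ∀ y : Y, ∃ (U : Type) (_ : CommRing U) (_ : IsDomain U) (_ : IsRegularRing U)
      (_ : Algebra k U) (_ : Algebra.FiniteType k U) (σ : U ≃ₐ[k] U) (_ : σ ^ p = 1)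
      (_ : ∀ (𝔮 : Ideal U) [𝔮.IsPrime], 𝔮.comap σ = 𝔮 →
        ((Ideal.span (Set.range fun u : U => σ u - u)).map
          (algebraMap U (Localization.AtPrime 𝔮))).IsPrincipal)
      (A : Type) (_ : AddCommGroup A) (_ : Finite A) (_ : DecidableEq A)
      (𝒮 : A → Submodule k (FixedPoints.subalgebra k U (Subgroup.zpowers σ)))
      (_ : GradedAlgebra 𝒮),
      ∃ φ : Spec (.of (𝒮 0)) ⟶ Y, Etale φ ∧ y ∈ Set.range φ ∧
        φ ≫ ψ ≫ f = Spec.map (CommRingCat.ofHom (algebraMap k (𝒮 0)))) :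
    Scheme.HasResolution X₁ := by
  haveI : IsSeparated (ψ ≫ f) := inferInstance
  haveI : LocallyOfFiniteType (ψ ≫ f) := inferInstance
  haveI : QuasiCompact (ψ ≫ f) := inferInstance
  refine ComponentGluing.Scheme.HasResolution.of_isBirational ψ hbir (hBR k Y (ψ ≫ f) fun y => ?_)
  obtain ⟨U, _, _, _, _, hft, σ, hσp, hdiv, A, _, _, _, 𝒮, _, φ, hφ, hy, hcomm⟩ := hcharts y
  haveI : Finite (Subgroup.zpowers σ) := finite_zpowers_of_pow_eq_one hp σ hσp
  haveI := hft
  -- `U^⟨σ⟩` is of finite type (E. Noether) and regular (Király–Lütkebohmert), hence smooth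
  have hSft : Algebra.FiniteType k (FixedPoints.subalgebra k U (Subgroup.zpowers σ)) :=
    inferInstance
  haveI : IsRegularRing (FixedPoints.subalgebra k U (Subgroup.zpowers σ)) :=
    isRegularRing_fixedPoints_zpowers_of_pow_eq_one hp σ hσp hdiv
  have hsm : Algebra.Smooth k (FixedPoints.subalgebra k U (Subgroup.zpowers σ)) :=
    ValuativeSmoothing.smooth_of_isRegularRing_of_perfectField k _
  exact ⟨A, inferInstance, inferInstance, inferInstance, _, inferInstance, inferInstance, 𝒮,
    inferInstance, hSft, hsm, φ, hφ, hy, hcomm⟩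

end Summit.ResolutionOfSingularities.ResolutionOfSingularities.Theorems.WildQuotientResolution.TameTransfer

end
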